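import Literature.MathematicalPhysics.QuantumFieldTheory.Balaban1983to89.Node00.U3KernelLetters
import Literature.MathematicalPhysics.QuantumFieldTheory.Balaban1983to89.B12Sec2to5

/-!
# K0⁷ V19 — STUB 3ᴬ′, THE FINITE-VOLUME FACE (FILE 1 of 2): ℤ⁴-PERIODICITY OF THE WINDOWED FINITE-TORUS POLARISATION KERNELS and a kernel-checked NEGATIVE CONTROL
# of the currency «K-uniform (5.10) ∕ all-finite-sets moments of `polWindow` on ℤ⁴» — it forces `β₁₃ ≡ 0` on the window

Cell `pub-ymgap`, width seat `pub-ymgap-k0-s3-w2` (g2; director-ym R399 (3a) ∕ №207 «(j,c)-generic sub-faces of `stub_absBetaBoxAtThm1WitnessCCMGen13` by CLAIM»; bus CLAIM-1 ∕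
INTENT-1 I.30390; the sub-face k0-s3-w1 g0's I.29137 left to this seat: «the finite-volume ∕ (5.10) ∕ `PolLimitExists` face»).  `--kind proof --supports stmt-QuantumFields-20541
--as helper` (count-neutral).  NEW leaf; theorems only; 0 `def`; nothing modified; no registry write.  Companion FILE 2 = `…K0Stub3FinVolFace` (the repaired currencies ⟹ 3ᴬ′ BY NAME).
[I] = [Balaban1987RG1]; [II] = [Balaban1989LargeFieldII]; [III] = [Balaban1988Convergent]; [15] = [Balaban1985Variational].

THE OBJECTS (all of record, none new).  `Node00.siteOfInt F K j : (Fin 4 → ℤ) → Site (F.P K) j` reads an integer vector on the torus `T^{(j)}` of the `K`-th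
approximation (coordinates `ZMod (2L^{m+K−j})`); `Node00.polWindow F K j ℰ ρ bV μ ν z` is the finite-volume scalar polarisation (1.20)–(1.21)₁ of a term functional `ℰ`
read at the sites `z` and `0`; `Node00.polLimit F j ℰ ρ bV μ ν z := limUnder atTop (K ↦ polWindow F K j (ℰ K) …)` is print's limit «T^{(j+1)} ↗ Z^d» (1.21); `B12Beta.secondMoment`
is (1.22); `B12Sec2to5.Decay510 P C δ₁` is (5.10) p.293 `|P z| ≤ C e^{−δ₁|z|₁}` on `ℤ⁴`; `betaOfRecord₁₃ F N θ` is the β of record ([I] (1.20)–(1.22) on the merged term (1.6)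
with the (2.9) species), equal ON the design box `]0, θ.γ]^{k+1}` to the `(0,1)` second moment of the `polLimit` of the merged term family of record
`mergedTermFamilyMatT F N (TβOfRecord₁₃ F N) (chiβOfRecord₁₃ F N θ) θ.εbg` (`betaOfRecord₁₃_eq_secondMoment_of_mem`).

§1 THE KERNEL FACT.  `siteOfInt` is ℤ⁴-PERIODIC with period `n_K(j) := (F.P K).sitesPerDir j = 2L^{m+K−j}` in every coordinate (`ZMod.natCast_self`), hence so is
every windowed finite-torus kernel: `polWindow F K j ℰ ρ bV μ ν (z + n_K(j)•w) = polWindow F K j ℰ ρ bV μ ν z` (`polWindow_add_period`); and the tori grow,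
`n_K(j) → ∞` in `K` at fixed `j` (`sitesPerDir_tendsto_atTop`).

§2 NEGATIVE CONTROL (kernel-checked; a typing finding on a CURRENCY, not on any idea or estimate).  A periodic function on `ℤ⁴` that is `≤ C e^{−δ₁|z|₁}` with `δ₁ > 0`
is identically `0` (translate by `t·n·𝟙`, let `t → ∞`); one whose singleton weighted moments `|P(z) z_μ z_ν|` are bounded is identically `0` as well.  HENCE: a
K-uniform (5.10)-decay of the WINDOWED finite-torus kernels on all of `ℤ⁴` (`∀ K, Decay510 (fun z => polWindow F K j (ℰ K) ρ bV μ ν z) C δ₁` — the body of ym-nodeO idea-6's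
sketch predicate `FinVolDecayOnBoxAt`, `Cruxes/Record13SepCoPHInhabited/HessCovHeredityK0Sketch.lean` §4) forces `polWindow ≡ 0`, `polLimit ≡ 0`, and — at every
`Stage13Params θ` — ★★ `betaOfRecord₁₃ F N θ k v = 0` on the whole window (`betaOfRecord₁₃_eq_zero_of_finVolDecayOnBox`; NO `PolLimitExists` needed); the all-finite-sets
moment currency (`FinVolAbsMomentOnBoxAt`) likewise (`betaOfRecord₁₃_eq_zero_of_finVolAbsMomentOnBox`); and (§2b) the `∀ K` form of W1's windowed NE9 letter
(`U3KernelLetters.WindowedNE9Forall`, `…ForallOfRecord₁₃`; offered binder, no consumer) with `κ > 0` forces HISTORY-BLIND finite-volume kernels on the window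
(`polWindow_historyBlind_of_windowedNE9Forall`) — its EVENTUAL twin `WindowedNE9` is the honest one.  So the sketch's two finite-volume roads to 3ᴬ′
(`absBox_of_finVolDecay_polLimit`, `absBox_of_finVolAbsMoment_polLimit`, `absBetaBoxGen_of_finVol…`) are correct theorems walked ONLY in the world `β₁₃ ≡ 0` on `]0, γ₀]`:
their hypotheses are met by no non-zero finite-volume polarisation.  Print's (5.10) [I] p.293 is a statement on the TORUS `T^{(j+1)}` (torus distance, i.e. the centred
fundamental domain), which the ℤ⁴-unwrapped window violates by periodicity — the currency, not the estimate, is at fault; FILE 2 states the two currencies print's objects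
CAN meet (eventually-in-`K` ∕ fundamental-domain) and derives 3ᴬ′ BY NAME from them.  (UNAFFECTED: every letter keyed on the LIMITING kernels `kernelA = polLimit` on `ℤ⁴` — `U3OfKernels.KernelDecayOfRecord₁₃`, N22's NE9, k0-s3-w1's
p608074 ∕ p609916 ∕ p610322 — and every EVENTUALLY-in-`K` letter of W1's `U3KernelLetters` (`PolLimitsExist`, `WindowedNE9`, `WindowedDecay`, `GeometricIncrements`), since
for each fixed `z` the torus eventually exceeds `|z|`.)  Imports: `Node00.U3KernelLetters` (W1's letters; brings `Node00.Record13`, `U3OfKernels`, `BetaOfRecord`), `B12Sec2to5`.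

HONEST FRAMING.  Elementary facts (periodicity in `ZMod`, limits of real sequences) and unfoldings of landed definitions; NO β estimate; nothing of Bałaban asserted;
stub 3ᴬ′ NOT proved — it remains NODE O's wall ([I] §1 p.264 «uniformly bounded» STATED, proof unpublished [II] p.355); stub 1 untouched; K0⁷ stmt-QuantumFields-20541 OPEN
(V19 87879403b3a26109 stands); counts unmoved (typed 28∕28 · discharged 5∕28 — the chair's words).  One finite 𝕋⁴ programme at fixed `ε = L^{−K}`, Bałaban AS PRINTED
— NOT continuum ∕ ℝ⁴ ∕ OS ∕ mass gap ∕ Clay: the Yang–Mills mass gap is NOT proved by any of this; route R4 closes the CONDITIONAL finite-𝕋⁴ rung `BalabanLadder.UV` only.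
No `sorry`, `def`, `instance`, `notation`, `axiom`.
-/

noncomputable section

open scoped Matrix.Norms.L2Operator
open Filter Topology

namespace Summit.QuantumFields.YangMills.Theorems.K0Stub3FinVolPeriodicity

open Literature.MathematicalPhysics.QuantumFieldTheory.Balaban1983to89
open Literature.MathematicalPhysics.QuantumFieldTheory.Balaban1983to89.Node00
open Literature.MathematicalPhysics.QuantumFieldTheory.Balaban1983to89.T4Continuum
open Literature.MathematicalPhysics.QuantumFieldTheory.Balaban1983to89.FlowStep
open Literature.MathematicalPhysics.QuantumFieldTheory.Balaban1983to89.B12Sec2to5 (Decay510 l1 l1_nonneg abs_coord_le_l1)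
open Literature.MathematicalPhysics.QuantumFieldTheory.Balaban1983to89.Node00.U3OfKernels (histPrefix)
open Literature.MathematicalPhysics.QuantumFieldTheory.Balaban1983to89.Node00.U3KernelLetters (WindowedNE9Forall WindowedNE9ForallOfRecord₁₃)

/-! ## §0  Two facts about real sequences (no lattice) -/

section Real

/-- A real number dominated by a vanishing geometric sequence is zero: `(∀ t, |a| ≤ B·r^t)`, `0 ≤ r < 1` ⟹ `a = 0`. [folklore] -/
theorem eq_zero_of_abs_le_geometric {a B r : ℝ} (hr₀ : 0 ≤ r) (hr₁ : r < 1) (h : ∀ t : ℕ, |a| ≤ B * r ^ t) : a = 0 := by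
  have hlim : Tendsto (fun t : ℕ => B * r ^ t) atTop (𝓝 (B * 0)) :=
    (tendsto_pow_atTop_nhds_zero_of_lt_one hr₀ hr₁).const_mul B
  rw [mul_zero] at hlim
  have h0 : |a| ≤ 0 := ge_of_tendsto' hlim h
  exact abs_eq_zero.mp (le_antisymm h0 (abs_nonneg a))

/-- A real number whose multiples `|a|·|c + n t|·|c′ + n t|` (`n > 0`) stay below a fixed `M` for all `t : ℕ` is zero. [folklore] -/
theorem eq_zero_of_abs_mul_affine_le {a c c' M : ℝ} {n : ℝ} (hn : 0 < n)
    (h : ∀ t : ℕ, |a| * |c + n * t| * |c' + n * t| ≤ M) : a = 0 := by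
  by_contra hne
  have hpos : 0 < |a| := abs_pos.mpr hne
  have h1 : Tendsto (fun t : ℕ => c + n * (t : ℝ)) atTop atTop :=
    tendsto_atTop_add_const_left _ _ (tendsto_natCast_atTop_atTop.const_mul_atTop hn)
  have h2 : Tendsto (fun t : ℕ => c' + n * (t : ℝ)) atTop atTop :=
    tendsto_atTop_add_const_left _ _ (tendsto_natCast_atTop_atTop.const_mul_atTop hn)
  have h12 : Tendsto (fun t : ℕ => |a| * |c + n * (t : ℝ)| * |c' + n * (t : ℝ)|) atTop atTop := by
    have hA := (tendsto_abs_atTop_atTop.comp h1)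
    have hB := (tendsto_abs_atTop_atTop.comp h2)
    have := (hA.atTop_mul_atTop₀ hB).const_mul_atTop hpos
    refine this.congr fun t => ?_
    simp only [Function.comp_apply]
    ring
  obtain ⟨t, ht⟩ := (h12.eventually_gt_atTop M).exists
  exact absurd (h t) (not_le.mpr ht)

end Real

/-! ## §1  The kernel fact: the window map and the windowed finite-torus kernels are ℤ⁴-periodic -/

section Periodicity

variable {𝔄 : Type*} [NormedRing 𝔄] [NormedAlgebra ℝ 𝔄]
variable {V : Type*} [NormedAddCommGroup V] [NormedSpace ℝ V] {ι : Type*} [Fintype ι]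

/-- **THE WINDOW MAP IS ℤ⁴-PERIODIC**: `siteOfInt F K j (z + n•w) = siteOfInt F K j z` for the period `n = (F.P K).sitesPerDir j = 2L^{m+K−j}` of the torus `T^{(j)}`
of the `K`-th approximation (coordinates in `ZMod n`). [cite: Balaban1987RG1, (0.1) p.251 and (1.21) p.264 (the torus `T^{(j+1)}`)] -/
theorem siteOfInt_add_period (F : T4Family) (K j : ℕ) (z w : Fin 4 → ℤ) :
    siteOfInt F K j (z + ((F.P K).sitesPerDir j : ℤ) • w) = siteOfInt F K j z := by
  funext i
  simp only [siteOfInt, Pi.add_apply, Pi.smul_apply, smul_eq_mul, Int.cast_add, Int.cast_mul, Int.cast_natCast,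
    ZMod.natCast_self, zero_mul, add_zero]

/-- **HENCE EVERY WINDOWED FINITE-TORUS KERNEL IS ℤ⁴-PERIODIC**: `Π_K(z + n•w) = Π_K(z)` for (1.20)–(1.21)₁ read through the window (the kernel lives on the finite
torus; unwrapping it to `ℤ⁴` repeats it). [cite: Balaban1987RG1, (1.20)–(1.21) p.264] -/
theorem polWindow_add_period (F : T4Family) (K j : ℕ) (ℰ : (Fin (F.P K).d → Site (F.P K) j → 𝔄) → ℝ)
    (ρ : V →L[ℝ] 𝔄) (bV : Module.Basis ι ℝ V) (μ ν : Fin 4) (z w : Fin 4 → ℤ) :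
    polWindow F K j ℰ ρ bV μ ν (z + ((F.P K).sitesPerDir j : ℤ) • w) = polWindow F K j ℰ ρ bV μ ν z := by
  unfold polWindow
  rw [siteOfInt_add_period]

/-- The period is positive: `0 < 2L^{m+K−j}`. [folklore] -/
theorem sitesPerDir_pos (F : T4Family) (K j : ℕ) : 0 < (F.P K).sitesPerDir j :=
  Nat.pos_of_ne_zero ((F.P K).sitesPerDir_ne_zero j)

/-- **THE TORI GROW**: at a fixed level `j` the number of sites per direction `2L^{m+K−j}` of `T^{(j)}` in the `K`-th approximation tends to `∞` with `K`
(`L > 1`) — so every fixed `z ∈ ℤ⁴` eventually lies in the centred fundamental window. [cite: Balaban1987RG1, (0.1) p.251 and (1.21) p.264 («T^{(j+1)} ↗ Z^d»)] -/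
theorem sitesPerDir_tendsto_atTop (F : T4Family) (j : ℕ) : Tendsto (fun K => (F.P K).sitesPerDir j) atTop atTop := by
  have h1 : Tendsto (fun K : ℕ => F.m + K - j) atTop atTop :=
    tendsto_atTop_atTop.mpr fun b => ⟨b + j, fun K hK => by omega⟩
  have h2 : Tendsto (fun n : ℕ => F.L ^ n) atTop atTop := tendsto_pow_atTop_atTop_of_one_lt F.hL.2
  refine tendsto_atTop_mono (fun K => ?_) (h2.comp h1)
  -- `(F.P K).sitesPerDir j = 2·L^{m+K−j}` (the tree's `…UVTorusDictionary.family_sitesPerDir`; re-derived inline to keep this leaf's imports inside NODE 00)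
  rw [show (F.P K).sitesPerDir j = 2 * F.L ^ (F.m + K - j) by simp [Params.sitesPerDir]]
  exact Nat.le_mul_of_pos_left _ two_pos

end Periodicity

/-! ## §2  NEGATIVE CONTROL: K-uniform (5.10)-decay ∕ all-finite-sets moment bounds on a WINDOWED finite-torus kernel force it to vanish -/

section Negative

/-- **A periodic function on `ℤ⁴` with exponential decay is zero** (period `n > 0` in the diagonal direction suffices): translate by `t·n·(1,1,1,1)`, the value is
unchanged while the majorant `C e^{−δ₁|z + tn𝟙|₁} ≤ C e^{δ₁|z|₁}·(e^{−δ₁ n})^t → 0`. [folklore] -/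
theorem eq_zero_of_periodic_of_decay510 {P : (Fin 4 → ℤ) → ℝ} {n : ℕ} (hn : 0 < n)
    (hper : ∀ z w : Fin 4 → ℤ, P (z + (n : ℤ) • w) = P z) {C δ₁ : ℝ} (hδ : 0 < δ₁) (h : Decay510 P C δ₁)
    (z : Fin 4 → ℤ) : P z = 0 := by
  have hn' : (0 : ℝ) < n := Nat.cast_pos.mpr hn
  -- `C ≥ 0` is forced by the decay at any point
  have hC : 0 ≤ C := by
    have h0 := h z
    have hexp := Real.exp_pos (-δ₁ * l1 z)
    nlinarith [abs_nonneg (P z)]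
  refine eq_zero_of_abs_le_geometric (B := C * Real.exp (δ₁ * l1 z)) (r := Real.exp (-δ₁ * n)) (Real.exp_pos _).le
    (Real.exp_lt_one_iff.mpr (by nlinarith)) fun t => ?_
  -- the translate `z_t := z + n • (t, t, t, t)`
  have hzt := h (z + (n : ℤ) • fun _ : Fin 4 => (t : ℤ))
  rw [hper] at hzt
  -- `|z|₁`-bookkeeping: `|z_t|₁ ≥ |z 0 + n t| ≥ n t − |z|₁`
  have hcoord : (n : ℝ) * t - l1 z ≤ l1 (z + (n : ℤ) • fun _ : Fin 4 => (t : ℤ)) := by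
    have h1 := abs_coord_le_l1 (z + (n : ℤ) • fun _ : Fin 4 => (t : ℤ)) 0
    have h2 := abs_coord_le_l1 z 0
    have hval : (((z + (n : ℤ) • fun _ : Fin 4 => (t : ℤ)) 0 : ℤ) : ℝ) = (z 0 : ℝ) + n * t := by
      push_cast [Pi.add_apply, Pi.smul_apply, smul_eq_mul]
      ring
    rw [hval] at h1
    have h3 : (n : ℝ) * t - |(z 0 : ℝ)| ≤ |(z 0 : ℝ) + n * t| := by
      have := abs_sub ((z 0 : ℝ) + n * t) (z 0 : ℝ)
      rw [add_sub_cancel_left, abs_of_nonneg (by positivity : (0 : ℝ) ≤ n * t)] at this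
      linarith
    linarith
  have hexp : Real.exp (-δ₁ * l1 (z + (n : ℤ) • fun _ : Fin 4 => (t : ℤ))) ≤ Real.exp (δ₁ * l1 z) * Real.exp (-δ₁ * n) ^ t := by
    rw [← Real.exp_nat_mul, ← Real.exp_add]
    exact Real.exp_le_exp.mpr (by nlinarith)
  calc |P z| ≤ C * Real.exp (-δ₁ * l1 (z + (n : ℤ) • fun _ : Fin 4 => (t : ℤ))) := hzt
    _ ≤ C * (Real.exp (δ₁ * l1 z) * Real.exp (-δ₁ * n) ^ t) := mul_le_mul_of_nonneg_left hexp hC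
    _ = C * Real.exp (δ₁ * l1 z) * Real.exp (-δ₁ * n) ^ t := by ring

/-- **A periodic function on `ℤ⁴` with bounded singleton weighted moments `|P(z) z_μ z_ν| ≤ M` is zero** (any `μ, ν`): translate by `t·n·𝟙`, the value is unchanged
while `|z_μ + nt|·|z_ν + nt| → ∞`. [folklore] -/
theorem eq_zero_of_periodic_of_absMoment_le {P : (Fin 4 → ℤ) → ℝ} {n : ℕ} (hn : 0 < n)
    (hper : ∀ z w : Fin 4 → ℤ, P (z + (n : ℤ) • w) = P z) (μ ν : Fin 4) {M : ℝ}
    (h : ∀ z : Fin 4 → ℤ, |P z * (z μ : ℝ) * (z ν : ℝ)| ≤ M) (z : Fin 4 → ℤ) : P z = 0 := by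
  refine eq_zero_of_abs_mul_affine_le (c := (z μ : ℝ)) (c' := (z ν : ℝ)) (M := M) (Nat.cast_pos.mpr hn : (0 : ℝ) < n) fun t => ?_
  have ht := h (z + (n : ℤ) • fun _ : Fin 4 => (t : ℤ))
  rw [hper] at ht
  have hval : ∀ i, (((z + (n : ℤ) • fun _ : Fin 4 => (t : ℤ)) i : ℤ) : ℝ) = (z i : ℝ) + n * t := fun i => by
    push_cast [Pi.add_apply, Pi.smul_apply, smul_eq_mul]
    ring
  rw [hval μ, hval ν, abs_mul, abs_mul] at ht
  exact ht

variable {𝔄 : Type*} [NormedRing 𝔄] [NormedAlgebra ℝ 𝔄]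
variable {V : Type*} [NormedAddCommGroup V] [NormedSpace ℝ V] {ι : Type*} [Fintype ι]

/-- **★ NEGATIVE CONTROL, decay form**: a (5.10)-type bound `|Π_K(z)| ≤ C e^{−δ₁|z|₁}` on ALL of `ℤ⁴` (`δ₁ > 0`) for the WINDOWED finite-torus kernel of ONE approximation
`K` forces that kernel to vanish identically — the unwrapped kernel is periodic (§1). [cite: Balaban1987RG1, (1.21) p.264 and (5.10) p.293 (typing of the currency)] -/
theorem polWindow_eq_zero_of_decay510 (F : T4Family) (K j : ℕ) (ℰ : (Fin (F.P K).d → Site (F.P K) j → 𝔄) → ℝ)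
    (ρ : V →L[ℝ] 𝔄) (bV : Module.Basis ι ℝ V) (μ ν : Fin 4) {C δ₁ : ℝ} (hδ : 0 < δ₁)
    (h : Decay510 (fun z => polWindow F K j ℰ ρ bV μ ν z) C δ₁) (z : Fin 4 → ℤ) :
    polWindow F K j ℰ ρ bV μ ν z = 0 :=
  eq_zero_of_periodic_of_decay510 (P := fun z => polWindow F K j ℰ ρ bV μ ν z) (sitesPerDir_pos F K j)
    (fun z w => polWindow_add_period F K j ℰ ρ bV μ ν z w) hδ h z

/-- **★ NEGATIVE CONTROL, moment form**: a bound `M` on all finite partial sums `Σ_{z∈S} |Π_K(z) z_μ z_ν|` over `ℤ⁴` for the WINDOWED finite-torus kernel of ONE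
approximation `K` forces that kernel to vanish identically (singletons `S = {z + tn𝟙}` already do). [cite: Balaban1987RG1, (1.21)–(1.22) p.264 (typing of the currency)] -/
theorem polWindow_eq_zero_of_absMomentBound (F : T4Family) (K j : ℕ) (ℰ : (Fin (F.P K).d → Site (F.P K) j → 𝔄) → ℝ)
    (ρ : V →L[ℝ] 𝔄) (bV : Module.Basis ι ℝ V) (μ ν : Fin 4) {M : ℝ}
    (h : ∀ S : Finset (Fin 4 → ℤ), ∑ z ∈ S, |polWindow F K j ℰ ρ bV μ ν z * (z μ : ℝ) * (z ν : ℝ)| ≤ M) (z : Fin 4 → ℤ) :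
    polWindow F K j ℰ ρ bV μ ν z = 0 :=
  eq_zero_of_periodic_of_absMoment_le (P := fun z => polWindow F K j ℰ ρ bV μ ν z) (sitesPerDir_pos F K j)
    (fun z w => polWindow_add_period F K j ℰ ρ bV μ ν z w) μ ν (fun z => by simpa using h {z}) z

/-- If every finite-volume window vanishes at `(μ, ν, z)`, the printed limit (1.21) there is `0` (a constant sequence converges; `ℝ` is Hausdorff).
[cite: Balaban1987RG1, (1.21) p.264 (bookkeeping)] -/
theorem polLimit_eq_zero_of_forall (F : T4Family) (j : ℕ) (ℰ : (K : ℕ) → (Fin (F.P K).d → Site (F.P K) j → 𝔄) → ℝ)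
    (ρ : V →L[ℝ] 𝔄) (bV : Module.Basis ι ℝ V) {μ ν : Fin 4} {z : Fin 4 → ℤ} (h : ∀ K, polWindow F K j (ℰ K) ρ bV μ ν z = 0) :
    polLimit F j ℰ ρ bV μ ν z = 0 :=
  polLimit_eq_of_tendsto F j ℰ ρ bV (by simp_rw [h]; exact tendsto_const_nhds)

/-- (1.22) of a kernel whose `(μ, ν)` slice vanishes is `0`. [cite: Balaban1987RG1, (1.22) p.264 (bookkeeping)] -/
theorem secondMoment_eq_zero_of_forall {P : B12Beta.Kernel 4} {μ ν : Fin 4} (h : ∀ z, P μ ν z = 0) : B12Beta.secondMoment P μ ν = 0 := by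
  simp [B12Beta.secondMoment, h]

variable (F : T4Family) (N : ℕ) [NeZero N]

/-- Windows shrink: `]0, γ₀]^{k+1} ⊆ ]0, γ]^{k+1}` for `γ₀ ≤ γ`. [folklore] -/
theorem box_mono_of_le {γ₀ γ : ℝ} (hle : γ₀ ≤ γ) {k : ℕ} {v : Fin (k + 1) → ℝ} (hv : v ∈ Box γ₀ k) : v ∈ Box γ k :=
  mem_box.mpr fun i => ⟨(mem_box.mp hv i).1, (mem_box.mp hv i).2.trans hle⟩

/-- On the design box the β of record IS the merged β = the `(0,1)` second moment (1.22) of the limiting kernel (1.21) of the merged term family of record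
(`betaOfRecord₁₃_eq_betaOfRecord₈Tχ` + `betaOfMerged_of_mem`, then unfolding `betaMerged`). [cite: Balaban1987RG1, (1.20)–(1.22) p.264 and (1.6) p.261] -/
theorem betaOfRecord₁₃_eq_secondMoment_of_mem (θ : Stage13Params F N) {k : ℕ} {v : Fin (k + 1) → ℝ} (hv : v ∈ Box θ.γ k) :
    betaOfRecord₁₃ F N θ k v =
      (letI := θ.instVβ₁; letI := θ.instVβ₂; letI := θ.instιβ
       B12Beta.secondMoment
         (polLimit F (k + 1) (fun K => mergedTermFamilyMatT F N (TβOfRecord₁₃ F N) (chiβOfRecord₁₃ F N θ) θ.εbg k v K) θ.ρ8 θ.bV) 0 1) := by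
  letI := θ.instVβ₁; letI := θ.instVβ₂; letI := θ.instιβ
  rw [betaOfRecord₁₃_eq_betaOfRecord₈Tχ]
  exact betaOfMerged_of_mem _ _ _ hv

/-- **★★ NEGATIVE CONTROL AT `θ`, decay form**: if the WINDOWED finite-torus kernels of the merged term of record obey a K-uniform (5.10)-type bound on all of `ℤ⁴` on
the window `]0, γ₀]` (`γ₀ ≤ θ.γ`, `δ₁ > 0`) — the body of idea-6's `FinVolDecayOnBoxAt θ γ₀ C δ₁` — then the β-functions of record VANISH IDENTICALLY on that window
(no limit-existence clause needed).  The «exponential finite-volume road» to 3ᴬ′ is walked only in the world `β₁₃ ≡ 0`. [cite: Balaban1987RG1, (1.20)–(1.22) p.264, (5.10) p.293] -/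
theorem betaOfRecord₁₃_eq_zero_of_finVolDecayOnBox (θ : Stage13Params F N) {γ₀ C δ₁ : ℝ} (hle : γ₀ ≤ θ.γ) (hδ : 0 < δ₁)
    (hD : letI := θ.instVβ₁; letI := θ.instVβ₂; letI := θ.instιβ
      ∀ k (v : Fin (k + 1) → ℝ), v ∈ Box γ₀ k → ∀ K,
        Decay510 (fun z => polWindow F K (k + 1)
          (mergedTermFamilyMatT F N (TβOfRecord₁₃ F N) (chiβOfRecord₁₃ F N θ) θ.εbg k v K) θ.ρ8 θ.bV 0 1 z) C δ₁)
    {k : ℕ} {v : Fin (k + 1) → ℝ} (hv : v ∈ Box γ₀ k) : betaOfRecord₁₃ F N θ k v = 0 := by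
  letI := θ.instVβ₁; letI := θ.instVβ₂; letI := θ.instιβ
  rw [betaOfRecord₁₃_eq_secondMoment_of_mem F N θ (box_mono_of_le hle hv)]
  refine secondMoment_eq_zero_of_forall fun z => polLimit_eq_zero_of_forall F (k + 1) _ θ.ρ8 θ.bV fun K => ?_
  exact polWindow_eq_zero_of_decay510 F K (k + 1) _ θ.ρ8 θ.bV 0 1 hδ (hD k v hv K) z

/-- **★★ NEGATIVE CONTROL AT `θ`, moment form**: the body of idea-6's `FinVolAbsMomentOnBoxAt θ γ₀ M` (K-uniform bounds on ALL finite partial sums over `ℤ⁴`) likewise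
forces `β₁₃ ≡ 0` on `]0, γ₀]`. [cite: Balaban1987RG1, (1.20)–(1.22) p.264] -/
theorem betaOfRecord₁₃_eq_zero_of_finVolAbsMomentOnBox (θ : Stage13Params F N) {γ₀ M : ℝ} (hle : γ₀ ≤ θ.γ)
    (hM : letI := θ.instVβ₁; letI := θ.instVβ₂; letI := θ.instιβ
      ∀ k (v : Fin (k + 1) → ℝ), v ∈ Box γ₀ k → ∀ K (S : Finset (Fin 4 → ℤ)),
        ∑ z ∈ S, |polWindow F K (k + 1)
            (mergedTermFamilyMatT F N (TβOfRecord₁₃ F N) (chiβOfRecord₁₃ F N θ) θ.εbg k v K) θ.ρ8 θ.bV 0 1 z *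
          (z 0 : ℝ) * (z 1 : ℝ)| ≤ M)
    {k : ℕ} {v : Fin (k + 1) → ℝ} (hv : v ∈ Box γ₀ k) : betaOfRecord₁₃ F N θ k v = 0 := by
  letI := θ.instVβ₁; letI := θ.instVβ₂; letI := θ.instιβ
  rw [betaOfRecord₁₃_eq_secondMoment_of_mem F N θ (box_mono_of_le hle hv)]
  refine secondMoment_eq_zero_of_forall fun z => polLimit_eq_zero_of_forall F (k + 1) _ θ.ρ8 θ.bV fun K => ?_
  exact polWindow_eq_zero_of_absMomentBound F K (k + 1) _ θ.ρ8 θ.bV 0 1 (hM k v hv K) z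

/-- Corollary (the shape of the sketch's conclusion, for comparison): under the decay-form currency the 3ᴬ-box holds with EVERY `β′ ≥ 0` — because `β₁₃ ≡ 0` there.
[cite: Balaban1987RG1, §1 p.264 («uniformly bounded»)] -/
theorem absBox_of_finVolDecayOnBox_trivial (θ : Stage13Params F N) {γ₀ C δ₁ β' : ℝ} (hle : γ₀ ≤ θ.γ) (hδ : 0 < δ₁) (hβ : 0 ≤ β')
    (hD : letI := θ.instVβ₁; letI := θ.instVβ₂; letI := θ.instιβ
      ∀ k (v : Fin (k + 1) → ℝ), v ∈ Box γ₀ k → ∀ K,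
        Decay510 (fun z => polWindow F K (k + 1)
          (mergedTermFamilyMatT F N (TβOfRecord₁₃ F N) (chiβOfRecord₁₃ F N θ) θ.εbg k v K) θ.ρ8 θ.bV 0 1 z) C δ₁) :
    BetaLowerH (-β') γ₀ (betaOfRecord₁₃ F N θ) ∧ BetaUpperH β' γ₀ (betaOfRecord₁₃ F N θ) := by
  constructor
  · intro k v hv
    rw [betaOfRecord₁₃_eq_zero_of_finVolDecayOnBox F N θ hle hδ hD hv]
    linarith
  · intro k v hv
    rw [betaOfRecord₁₃_eq_zero_of_finVolDecayOnBox F N θ hle hδ hD hv]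
    exact hβ

end Negative

/-! ## §2b  NEGATIVE CONTROL for the `∀ K` form of the windowed NE9 letter: it forces HISTORY-BLIND finite-volume kernels -/

section HistoryBlind

/-- Two period-`n` functions on `ℤ⁴` whose difference is `≤ S·e^{−κ|z|₁}` everywhere (`κ > 0`) are EQUAL (§2 applied to the difference). [folklore] -/
theorem eq_of_periodic_of_abs_sub_le_exp {P Q : (Fin 4 → ℤ) → ℝ} {n : ℕ} (hn : 0 < n)
    (hP : ∀ z w : Fin 4 → ℤ, P (z + (n : ℤ) • w) = P z) (hQ : ∀ z w : Fin 4 → ℤ, Q (z + (n : ℤ) • w) = Q z)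
    {S κ : ℝ} (hκ : 0 < κ) (h : ∀ z, |P z - Q z| ≤ Real.exp (-(κ * l1 z)) * S) (z : Fin 4 → ℤ) : P z = Q z := by
  have hD : Decay510 (fun z => P z - Q z) S κ := fun z => by
    rw [neg_mul, mul_comm S]
    exact h z
  have := eq_zero_of_periodic_of_decay510 (P := fun z => P z - Q z) hn (fun z w => by simp only [hP, hQ]) hκ hD z
  exact sub_eq_zero.mp this

variable {𝔄 : Type*} [NormedRing 𝔄] [NormedAlgebra ℝ 𝔄]
variable {V : Type*} [NormedAddCommGroup V] [NormedSpace ℝ V] {ι : Type*} [Fintype ι]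

/-- **★ NEGATIVE CONTROL for `U3KernelLetters.WindowedNE9Forall`** (W1's `∀ K` form of the windowed joint history-Lipschitz letter; an OFFERED binder with no consumer in the tree):
with `κ > 0` it forces the WINDOWED finite-torus kernels to be HISTORY-BLIND on the window — `Π_K(g; z) = Π_K(g′; z)` for all `g, g′ ∈ W`, every `K, k, μ, ν, z` — because the
difference of two periodic kernels bounded by `e^{−κ|z|₁}·(row sum)` on all of `ℤ⁴` vanishes (§2).  The EVENTUAL form `WindowedNE9` (for each fixed `z`, all large `K`) is the honest
currency and is unaffected. [cite: Balaban1987RG1, (1.18) p.263 and (1.20)–(1.21) p.264 (typing of the currency)] -/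
theorem polWindow_historyBlind_of_windowedNE9Forall (F : T4Family) (ℰ : TermFamily1 F 𝔄) (ρ : V →L[ℝ] 𝔄) (bV : Module.Basis ι ℝ V)
    {W : Set (ℕ → ℝ)} {κ : ℝ} {Λ : ℕ → ℕ → ℝ} (hκ : 0 < κ) (h : WindowedNE9Forall F ℰ ρ bV W κ Λ)
    {g g' : ℕ → ℝ} (hg : g ∈ W) (hg' : g' ∈ W) (K k : ℕ) (μ ν : Fin 4) (z : Fin 4 → ℤ) :
    polWindow F K (k + 1) (ℰ k (histPrefix g k) K) ρ bV μ ν z = polWindow F K (k + 1) (ℰ k (histPrefix g' k) K) ρ bV μ ν z :=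
  eq_of_periodic_of_abs_sub_le_exp (sitesPerDir_pos F K (k + 1))
    (fun z w => polWindow_add_period F K (k + 1) _ ρ bV μ ν z w) (fun z w => polWindow_add_period F K (k + 1) _ ρ bV μ ν z w)
    hκ (fun z => h g hg g' hg' K k μ ν z) z

variable (F : T4Family) (N : ℕ) [NeZero N]

/-- **★ … AT THE RECORD**: `U3KernelLetters.WindowedNE9ForallOfRecord₁₃ F N θ κ Λ` with `κ > 0` forces the windowed finite-torus kernels of the merged term of record to be
history-blind on `]0, θ.γ]^ℕ` (a property print's objects do not have — [I] p.298 «β_j depends also on all preceding coupling constants»); the eventual letter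
`WindowedNE9OfRecord₁₃` is the one to supply. [cite: Balaban1987RG1, (1.18) p.263, §5 p.298 (typing of the currency)] -/
theorem polWindow_historyBlind_of_windowedNE9ForallOfRecord₁₃ (θ : Stage13Params F N) {κ : ℝ} {Λ : ℕ → ℕ → ℝ} (hκ : 0 < κ)
    (h : WindowedNE9ForallOfRecord₁₃ F N θ κ Λ) {g g' : ℕ → ℝ} (hg : g ∈ T4OutputRate.Window θ.γ) (hg' : g' ∈ T4OutputRate.Window θ.γ)
    (K k : ℕ) (μ ν : Fin 4) (z : Fin 4 → ℤ) :
    letI := θ.instVβ₁; letI := θ.instVβ₂; letI := θ.instιβ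
    polWindow F K (k + 1) (mergedTermFamilyMatT F N (TβOfRecord₁₃ F N) (chiβOfRecord₁₃ F N θ) θ.εbg k (histPrefix g k) K) θ.ρ8 θ.bV μ ν z =
      polWindow F K (k + 1) (mergedTermFamilyMatT F N (TβOfRecord₁₃ F N) (chiβOfRecord₁₃ F N θ) θ.εbg k (histPrefix g' k) K) θ.ρ8 θ.bV μ ν z := by
  letI := θ.instVβ₁; letI := θ.instVβ₂; letI := θ.instιβ
  exact polWindow_historyBlind_of_windowedNE9Forall F _ θ.ρ8 θ.bV hκ h hg hg' K k μ ν z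

end HistoryBlind

end Summit.QuantumFields.YangMills.Theorems.K0Stub3FinVolPeriodicity

end
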